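import Literature.IUT.HodgeArakelov.MonoThetaFromGroups
import Literature.AnabelianGeometry.EtaleTheta.ContH1
import Literature.AnabelianGeometry.EtaleTheta.ContH1Lemmas
import Mathlib.Algebra.Colimit.Module

/-!
# Bridge: the interface `CohomologySystem` ([IUTchII] Prop 1.4) instantiated from continuous `H¹`

MERGE-MAP (plan/L6/MERGE-MAP.md) §2, row `MonoThetaFromGroups.lean :226 CohomologySystem` ↔ L2-t1
`Literature.AnabelianGeometry.EtaleTheta.ContH1` (BUILT): "BRIDGE: instantiate the system's `H¹`-slots with
`ContH1`". S. Mochizuki, *Inter-universal Teichmüller theory II*, kurims manuscript (Dec. 2020), Prop. 1.4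
p. 27: "`∞θ(Π) ⊆ lim_J H¹(Π_Ÿ(Π)|_J, (l·Δ_Θ)(Π))` … where `J` ranges over the finite index open subgroups of
`Π`" (and Cor. 1.12 (a) p. 56: "`|_J` denotes the fiber product `×_Π J`"). The landed interface
`CohomologySystem P` (abc-iut-L6-t1, `MonoThetaFromGroups.lean`, p406189) carries, for EVERY subgroup
`J ≤ Π`, a module `H1 J` ("`H¹(H|_J, A)`"), restriction maps along `J' ≤ J`, a limit `lim` and compatible maps
`toLim J`. L2's `ContH1 φ A H` ([EtTh] §1 support, abc-iut-L2-t1, p404763) is continuous `H¹` by crossed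
homomorphisms with `res`.

THE INSTANTIATION (`cohomologySystemOfContH1 φ A H`): `H1 J :=` the direct limit (Mathlib
`AddCommGroup.DirectLimit`) of `H¹(H ⊓ K, A)` over the finite-index OPEN subgroups `K ⊇ J`, ordered by
reverse inclusion; `res` and `toLim J := res (⊥ ≤ J)` by the universal property; `lim := H1 ⊥` = the direct
limit over ALL finite-index open `K` = the printed `lim_J H¹(H|_J, A)`; `toLim_res` = functoriality. For a
finite-index open `J` the index set has the final object `J`, so `H1 J ≅ H¹(H ⊓ J, A)` canonically
(`h1EquivOfFiniteIndexOpen`; at `J = ⊤`: `H¹(H ⊓ ⊤, A)`, i.e. `H¹(Π_Ÿ(Π), ·)`).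

DESIGN NOTE recorded for consumers (honest reading of the landed interface): `CohomologySystem.toLim_res`
quantifies over ALL subgroups `J' ≤ J`, and `⊥` is below everything; an instantiation with `H1 J` LITERALLY
`H¹(H ⊓ J, A)` at every `J` would force `toLim J = toLim ⊥ ∘ res` to factor through `H¹(1, A) = 0`. Hence the
value of `H1` at a subgroup that is NOT finite-index open must be the hull colimit above (for `J = ⊥`: the
whole limit), which is what this file does; at the subgroups the text actually uses (finite-index open `J`,
in particular `J = ⊤`) it is the genuine `H¹`. Claim key of the interface: `Mochizuki2012` (D-0012, disputed);
this bridge asserts nothing of [IUTchII] — it is a construction over Mathlib + the two landed files.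
-/

namespace Literature.IUT.HodgeArakelov

open Literature.AnabelianGeometry.EtaleTheta

universe u

noncomputable section

variable {P : TopGroup.{u}} {G' : Type u} [Group G'] [TopologicalSpace G'] [IsTopologicalGroup G']
  (φ : P →* G') (A : Subgroup G') [A.Normal] [IsMulCommutative A] (H : Subgroup P)

namespace CohomologySystemOfContH1

/-- The index set at `J`: finite-index OPEN subgroups `K ⊇ J` of `Π`, as a subtype of `Subgroup Π`; it is
used with the REVERSE inclusion order (`ᵒᵈ`), along which restriction maps go.
[cite: Mochizuki2012, Prop 1.4 p.27] -/
abbrev FioOver (J : Subgroup P) : Type u :=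
  {K : Subgroup P // K.FiniteIndex ∧ IsOpen (K : Set P) ∧ J ≤ K}

/-- The index poset `(FioOver J)ᵒᵈ`. [cite: Mochizuki2012, Prop 1.4 p.27] -/
abbrev Idx (J : Subgroup P) : Type u := (FioOver (P := P) J)ᵒᵈ

/-- Equality of indices is decided classically (needed by `AddCommGroup.DirectLimit`).
[cite: Mochizuki2012, Prop 1.4 p.27] -/
noncomputable instance Idx.instDecidableEq (J : Subgroup P) : DecidableEq (Idx (P := P) J) :=
  Classical.decEq _

/-- The subgroup underlying an index. [cite: Mochizuki2012, Prop 1.4 p.27] -/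
abbrev Idx.K {J : Subgroup P} (i : Idx (P := P) J) : Subgroup P := (OrderDual.ofDual i).1

/-- `i ≤ j` in the index poset means `K_j ⊆ K_i`. [cite: Mochizuki2012, Prop 1.4 p.27] -/
theorem Idx.le_iff {J : Subgroup P} {i j : Idx (P := P) J} : i ≤ j ↔ j.K ≤ i.K := Iff.rfl

/-- `⊤` as an index over any `J` (the index sets are nonempty). [cite: Mochizuki2012, Prop 1.4 p.27] -/
def Idx.top (J : Subgroup P) : Idx (P := P) J :=
  OrderDual.toDual ⟨⊤, inferInstance, by simp, le_top⟩

/-- The index of a finite-index open `J` over itself (the FINAL object of `Idx J`). [cite: Mochizuki2012, Prop 1.4 p.27] -/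
def Idx.self (J : Subgroup P) (hJ : J.FiniteIndex) (hJo : IsOpen (J : Set P)) : Idx (P := P) J :=
  OrderDual.toDual ⟨J, hJ, hJo, le_rfl⟩

/-- Every index over `J` lies below `Idx.self J` (i.e. `J ⊆ K`). [cite: Mochizuki2012, Prop 1.4 p.27] -/
theorem Idx.le_self {J : Subgroup P} (hJ : J.FiniteIndex) (hJo : IsOpen (J : Set P)) (i : Idx (P := P) J) :
    i ≤ Idx.self J hJ hJo :=
  (OrderDual.ofDual i).2.2.2

/-- Change of base `J' ≤ J`: an index over `J` is an index over `J'`. [cite: Mochizuki2012, Prop 1.4 p.27] -/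
def Idx.incl {J J' : Subgroup P} (h : J' ≤ J) (i : Idx (P := P) J) : Idx (P := P) J' :=
  OrderDual.toDual ⟨i.K, (OrderDual.ofDual i).2.1, (OrderDual.ofDual i).2.2.1,
    h.trans (OrderDual.ofDual i).2.2.2⟩

/-- `incl` does not change the underlying subgroup. [cite: Mochizuki2012, Prop 1.4 p.27] -/
@[simp] theorem Idx.K_incl {J J' : Subgroup P} (h : J' ≤ J) (i : Idx (P := P) J) : (i.incl h).K = i.K := rfl

/-- The index poset is directed (intersections of finite-index open subgroups are finite-index open).
[cite: Mochizuki2012, Prop 1.4 p.27] -/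
theorem Idx.isDirected (J : Subgroup P) : IsDirectedOrder (Idx (P := P) J) := by
  refine ⟨fun i j => ?_⟩
  haveI := (OrderDual.ofDual i).2.1
  haveI := (OrderDual.ofDual j).2.1
  refine ⟨OrderDual.toDual ⟨i.K ⊓ j.K, inferInstance,
    (OrderDual.ofDual i).2.2.1.inter (OrderDual.ofDual j).2.2.1,
    le_inf (OrderDual.ofDual i).2.2.2 (OrderDual.ofDual j).2.2.2⟩, ?_, ?_⟩
  · exact (inf_le_left : i.K ⊓ j.K ≤ i.K)
  · exact (inf_le_right : i.K ⊓ j.K ≤ j.K)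

/-- The modules of the system at `J`: `K ↦ H¹(H ⊓ K, A)` (additively written, as in [IUTchII]: "the module
structure [i.e., which is usually denoted additively!]"). [cite: Mochizuki2012, Prop 1.4 p.27] -/
abbrev Gmod (J : Subgroup P) (i : Idx (P := P) J) : Type u := Additive (ContH1 φ A (H ⊓ i.K))

/-- The transition maps: restriction `H¹(H ⊓ K_i, A) → H¹(H ⊓ K_j, A)` for `i ≤ j` (`K_j ⊆ K_i`).
[cite: Mochizuki2012, Prop 1.4 p.27] -/
def fmod (J : Subgroup P) (i j : Idx (P := P) J) (hij : i ≤ j) : Gmod φ A H J i →+ Gmod φ A H J j :=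
  MonoidHom.toAdditive (ContH1.res φ A (inf_le_inf_left H (Idx.le_iff.mp hij)))

/-- Restriction along `le_rfl` is the identity on `ContH1`. [cite: NeukirchSchmidtWingberg2008, I §5] -/
theorem res_refl_apply {H₁ : Subgroup P} (x : ContH1 φ A H₁) : ContH1.res φ A (le_refl H₁) x = x := by
  induction x using QuotientGroup.induction_on with
  | H f => rfl

/-- The system `(Gmod, fmod)` is a directed system (functoriality of restriction).
[cite: NeukirchSchmidtWingberg2008, I §5] -/
theorem directedSystem (J : Subgroup P) :
    DirectedSystem (Gmod φ A H J) fun i j hij => fmod φ A H J i j hij := by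
  constructor
  · intro i x
    exact congrArg Additive.ofMul (res_refl_apply φ A (Additive.toMul x))
  · intro i j k hij hjk x
    exact congrArg Additive.ofMul (ContH1.res_res _ _ (Additive.toMul x))

end CohomologySystemOfContH1

open CohomologySystemOfContH1

/-- `H1 J :=` the direct limit of `H¹(H ⊓ K, A)` over the finite-index open `K ⊇ J` (DEFINED).
[cite: Mochizuki2012, Prop 1.4 p.27] -/
def h1Lim (J : Subgroup P) : Type u :=
  AddCommGroup.DirectLimit (Gmod φ A H J) (fmod φ A H J)

/-- `H1 J` is an abelian group (the direct limit's structure). [cite: Mochizuki2012, Prop 1.4 p.27] -/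
instance h1Lim.instAddCommGroup (J : Subgroup P) : AddCommGroup (h1Lim φ A H J) :=
  inferInstanceAs (AddCommGroup (AddCommGroup.DirectLimit (Gmod φ A H J) (fmod φ A H J)))

/-- The canonical map `H¹(H ⊓ K, A) → H1 J` of an index `K ⊇ J`. [cite: Mochizuki2012, Prop 1.4 p.27] -/
def h1Of (J : Subgroup P) (i : Idx (P := P) J) : Gmod φ A H J i →+ h1Lim φ A H J :=
  AddCommGroup.DirectLimit.of (Gmod φ A H J) (fmod φ A H J) i

/-- Compatibility of `h1Of` with the transition maps. [cite: Mochizuki2012, Prop 1.4 p.27] -/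
theorem h1Of_fmod (J : Subgroup P) {i j : Idx (P := P) J} (hij : i ≤ j) (x : Gmod φ A H J i) :
    h1Of φ A H J j (fmod φ A H J i j hij x) = h1Of φ A H J i x :=
  AddCommGroup.DirectLimit.of_f (G := Gmod φ A H J) (f := fmod φ A H J) hij x

/-- The restriction `H1 J → H1 J'` for `J' ≤ J`, by the universal property (every index over `J` is an
index over `J'`). [cite: Mochizuki2012, Prop 1.4 p.27] -/
def h1Res {J J' : Subgroup P} (h : J' ≤ J) : h1Lim φ A H J →+ h1Lim φ A H J' :=
  AddCommGroup.DirectLimit.lift (Gmod φ A H J) (fmod φ A H J) (h1Lim φ A H J')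
    (fun i => h1Of φ A H J' (i.incl h))
    (fun i j hij x => h1Of_fmod φ A H J' (i := i.incl h) (j := j.incl h) hij x)

/-- `h1Res` on generators. [cite: Mochizuki2012, Prop 1.4 p.27] -/
@[simp] theorem h1Res_of {J J' : Subgroup P} (h : J' ≤ J) (i : Idx (P := P) J) (x : Gmod φ A H J i) :
    h1Res φ A H h (h1Of φ A H J i x) = h1Of φ A H J' (i.incl h) x :=
  AddCommGroup.DirectLimit.lift_of (G := Gmod φ A H J) (f := fmod φ A H J) _ _ _ i x

/-- Two additive maps out of `H1 J` agreeing on all generators are equal. [cite: Mochizuki2012, Prop 1.4 p.27] -/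
theorem h1Lim_hom_ext {J : Subgroup P} {M : Type u} [AddCommGroup M] {g₁ g₂ : h1Lim φ A H J →+ M}
    (hg : ∀ (i : Idx (P := P) J) (x : Gmod φ A H J i), g₁ (h1Of φ A H J i x) = g₂ (h1Of φ A H J i x)) :
    g₁ = g₂ :=
  AddCommGroup.DirectLimit.hom_ext (G := Gmod φ A H J) (f := fmod φ A H J) M
    fun i => AddMonoidHom.ext (hg i)

/-- Functoriality: `res_{J',J''} ∘ res_{J,J'} = res_{J,J''}`. [cite: Mochizuki2012, Prop 1.4 p.27] -/
theorem h1Res_h1Res {J J' J'' : Subgroup P} (h : J' ≤ J) (h' : J'' ≤ J') (x : h1Lim φ A H J) :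
    h1Res φ A H h' (h1Res φ A H h x) = h1Res φ A H (h'.trans h) x := by
  have : (h1Res φ A H h').comp (h1Res φ A H h) = h1Res φ A H (h'.trans h) :=
    h1Lim_hom_ext φ A H fun i y => by simp [h1Res_of]; rfl
  exact DFunLike.congr_fun this x

/-- **The bridge**: the interface `CohomologySystem Π` of [IUTchII] Prop. 1.4 INSTANTIATED from continuous
cohomology `H¹(H ⊓ K, A)` (`ContH1`), `K` finite-index open, with `lim = lim_K H¹(H|_K, A)` as printed.
[cite: Mochizuki2012, Prop 1.4 p.27] -/
def cohomologySystemOfContH1 : CohomologySystem P where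
  H1 := h1Lim φ A H
  res h := h1Res φ A H h
  lim := h1Lim φ A H ⊥
  toLim J := h1Res φ A H (bot_le : ⊥ ≤ J)
  toLim_res h x := h1Res_h1Res φ A H h bot_le x

/-! ## At a finite-index open `J`: `H1 J ≅ H¹(H ⊓ J, A)` -/

/-- For finite-index open `J`, the comparison `H1 J → H¹(H ⊓ J, A)`: restrict every `H¹(H ⊓ K, A)`,
`K ⊇ J`, to `H ⊓ J`. [cite: Mochizuki2012, Prop 1.4 p.27] -/
def h1ToSelf (J : Subgroup P) (hJ : J.FiniteIndex) (hJo : IsOpen (J : Set P)) :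
    h1Lim φ A H J →+ Additive (ContH1 φ A (H ⊓ J)) :=
  AddCommGroup.DirectLimit.lift (Gmod φ A H J) (fmod φ A H J) _
    (fun i => fmod φ A H J i (Idx.self J hJ hJo) (Idx.le_self hJ hJo i))
    (fun _ _ _ x => congrArg Additive.ofMul (ContH1.res_res _ _ (Additive.toMul x)))

/-- `h1ToSelf` on generators: restriction to `H ⊓ J`. [cite: Mochizuki2012, Prop 1.4 p.27] -/
@[simp] theorem h1ToSelf_of (J : Subgroup P) (hJ : J.FiniteIndex) (hJo : IsOpen (J : Set P))
    (i : Idx (P := P) J) (y : Gmod φ A H J i) :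
    h1ToSelf φ A H J hJ hJo (h1Of φ A H J i y) =
      fmod φ A H J i (Idx.self J hJ hJo) (Idx.le_self hJ hJo i) y :=
  AddCommGroup.DirectLimit.lift_of (G := Gmod φ A H J) (f := fmod φ A H J) _ _ _ i y

/-- **`H1 J ≅ H¹(H ⊓ J, A)`** for finite-index open `J` (the index set has the final object `J`); in
particular `H1 ⊤ ≅ H¹(H, A)` realises "`θ(Π) ⊆ H¹(Π_Ÿ(Π), (l·Δ_Θ)(Π))`" on genuine classes.
[cite: Mochizuki2012, Prop 1.4 p.27] -/
def h1EquivOfFiniteIndexOpen (J : Subgroup P) (hJ : J.FiniteIndex) (hJo : IsOpen (J : Set P)) :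
    h1Lim φ A H J ≃+ Additive (ContH1 φ A (H ⊓ J)) where
  toFun := h1ToSelf φ A H J hJ hJo
  invFun := h1Of φ A H J (Idx.self J hJ hJo)
  left_inv := by
    haveI := Idx.isDirected (P := P) J
    haveI : Nonempty (Idx (P := P) J) := ⟨Idx.top J⟩
    intro x
    induction x using AddCommGroup.DirectLimit.induction_on with
    | ih i y =>
      change h1Of φ A H J (Idx.self J hJ hJo) (h1ToSelf φ A H J hJ hJo (h1Of φ A H J i y)) =
        h1Of φ A H J i y
      rw [h1ToSelf_of]
      exact h1Of_fmod φ A H J (Idx.le_self hJ hJo i) y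
  right_inv := by
    intro y
    rw [h1ToSelf_of]
    exact congrArg Additive.ofMul (res_refl_apply φ A (Additive.toMul y))
  map_add' := map_add _

/-- NATURALITY of the comparison: under `H1 J ≅ H¹(H ⊓ J, A)` (finite-index open `J' ≤ J`) the
system's restriction `H1 J → H1 J'` is the restriction `H¹(H ⊓ J, A) → H¹(H ⊓ J', A)` of `ContH1`.
[cite: Mochizuki2012, Prop 1.4 p.27] -/
theorem h1Equiv_h1Res {J J' : Subgroup P} (hJ : J.FiniteIndex) (hJo : IsOpen (J : Set P))
    (hJ' : J'.FiniteIndex) (hJ'o : IsOpen (J' : Set P)) (h : J' ≤ J) (x : h1Lim φ A H J) :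
    h1EquivOfFiniteIndexOpen φ A H J' hJ' hJ'o (h1Res φ A H h x) =
      MonoidHom.toAdditive (ContH1.res φ A (inf_le_inf_left H h))
        (h1EquivOfFiniteIndexOpen φ A H J hJ hJo x) := by
  haveI := Idx.isDirected (P := P) J
  haveI : Nonempty (Idx (P := P) J) := ⟨Idx.top J⟩
  induction x using AddCommGroup.DirectLimit.induction_on with
  | ih i y =>
    change h1ToSelf φ A H J' hJ' hJ'o (h1Res φ A H h (h1Of φ A H J i y)) =
      MonoidHom.toAdditive (ContH1.res φ A (inf_le_inf_left H h)) (h1ToSelf φ A H J hJ hJo (h1Of φ A H J i y))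
    rw [h1Res_of, h1ToSelf_of, h1ToSelf_of]
    exact congrArg Additive.ofMul (ContH1.res_res _ _ (Additive.toMul y)).symm

/-- The canonical map `H¹(H ⊓ J, A) → lim` (finite-index open `J`) of the instantiated system is the
colimit injection of the index `J`: `toLim J ∘ (H1 J ≅ H¹(H ⊓ J))⁻¹ = of J`.
[cite: Mochizuki2012, Prop 1.4 p.27] -/
theorem toLim_h1Equiv_symm (J : Subgroup P) (hJ : J.FiniteIndex) (hJo : IsOpen (J : Set P))
    (y : Additive (ContH1 φ A (H ⊓ J))) :
    (cohomologySystemOfContH1 φ A H).toLim J ((h1EquivOfFiniteIndexOpen φ A H J hJ hJo).symm y) =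
      h1Of φ A H ⊥ ((Idx.self J hJ hJo).incl bot_le) y :=
  h1Res_of φ A H bot_le (Idx.self J hJ hJo) y

end

end Literature.IUT.HodgeArakelov
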